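import Literature.NumberTheory.EllipticCurves.FineSelmerReducibleIsotypicLayerZeroDoors
import Literature.NumberTheory.EllipticCurves.FineSelmerClassGroupCriterionCyclotomicTower
import Summits.BirchSwinnertonDyer.BirchSwinnertonDyer.Theorems.KatoDescentPotSupersingularReducibleCharacterFieldsDoors
import HarnessLib

/-!
# THE LAYER-ZERO PER-ROW DOOR of crux M: (A) at `(W, p)` on a reducible row when EACH character `χ₁` (on `C`), `χ₂` (on `W[p]/C`)
# passes EITHER door L6 at layer 0 (no `χ_i`-eigenline in `Cl(ℚ(χ_i)) ⊗ 𝔽_p`, `p` not totally split in `ℚ(χ_i)`) OR g38's three-way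
# `μ`-door (Iwasawa 1956 ∨ Fukuda ∨ one-layer small rank) (route-free helper for crux M = stmt-BirchSwinnertonDyer-19196
# `ReducibleKatoMember`, K9 / K8-t′; seat `bsd-potss-rkm` g39)

WHY.  The `μ`-input of crux M's kernel chain on a reducible row is statement (A) at `(W, p)`.  g38's two-field door asks `μ_p = 0` of
the two cyclic character fields `ℚ(χ₁) = ℚ(P)`, `ℚ(χ₂) = ℚ(P′)` (class groups at layer 0 AND, when Iwasawa 1956 fails, at layer 1 —
degree `p·[ℚ(χ_i):ℚ]`, out of reach for the residual `p = 7, 11, 17` rows).  The ISOTYPIC reading needs only the `χ_i`-isotypic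
component, which conjA-anchor g16's door L6 (Washington §13.3) controls from LAYER-ZERO data; the Literature files
`FineSelmerReducibleIsotypicLayerZero{,Doors}` + `EquivariantHomLayerOfAbsolute` of this generation give (A) from, per side: a subfield
`K_i ⊆ ℚ(χ₁,χ₂)` fixing a generator, the eigen-test «every additive `μ : Cl(𝓞_{K_i}) → ZMod p` with `μ([σ̄I]) = a·μ([I])` whenever
`τ|_{K_i} = σ̄`, `τ•P_i ≡ a•P_i` vanishes» (numerically: the `χ_i(g)`-eigenspace of a generator `g` of `Gal(ℚ(χ_i)/ℚ)` on
`Cl(ℚ(χ_i)) ⊗ 𝔽_p` is `0`), and `V_i^{D_p} = 0` (numerically: `p` not totally split in `ℚ(χ_i)`).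

* `fineSelmerDual_moduleFinite_of_reducible_of_layerZero_or_classicalMuVanishes` (any number field, ramified-prime hypothesis) —
  per side: layer-zero door OR `μ = 0` for every cyclotomic `ℤ_p`-extension of `K̄^{ker χ_i}`;
* **`fineSelmerDual_moduleFinite_of_not_irreducible_of_layerZero_or_doors`** — THE PER-ROW DOOR over `ℚ`: per side, layer-zero door
  OR g38's three-way `μ`-door at `ℚ(χ_i)`;
* `fineSelmerDual_moduleFinite_of_reducible_of_eigenTests` — the canonical subfields `K₁ = F^{res(fixingSubgroup C)}`,
  `K₂ = F^{res(ker χ₂)}` built in: only the two eigen-tests and the two decomposition conditions remain;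
* `line_fixed_eq_zero_of_geomPrimaryTorsion` — (c3*)₁ from the cell's `W(ℚ_p)[p] = 0` currency.

CENSUS (kit job of this generation, evidence on the item; 656 K8-t′ X3 reducible `r_an = 0` rows, `p ≥ 5`): layer-zero door on BOTH
sides on 41/41 rows at `p = 7`, 17/17 at `p = 11`, 7/7 at `p = 17` (all 25 residual rows of g38's census, decided at layer 0) and
407/591 at `p = 5`; with g38's door 614/656 rows are GRH-free, 42 under GRH (24 uncertified degree-10/16 class groups, 18 layer-1).
HONEST FRAMING.  Theorems only; route-free; closes nothing: crux M stays cite-level over {Fine, H2X⁺, modularity} and, class-wide, the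
`μ`-input `H_IC`; no class group is computed in Lean; BSD is proved for no curve.
References: [CoatesSujatha2005] Thm. 3.4, L. 3.8, Cor. 3.6; [DeoRaySujatha2023] §3 Thm. 3.8, §5 L. 5.1; [Washington1997] §10.1, §13.3;
[Wuthrich2014] L. 14; [Greenberg2001IwasawaPastPresent] Prop. 2.1.
-/

-- the summit and its single problem are both named `BirchSwinnertonDyer` (registry layout D-0017)
set_option linter.dupNamespace false
set_option autoImplicit false

noncomputable section

open scoped Classical Pointwise NumberField nonZeroDivisors
open Field NumberField IsDedekindDomain IntermediateField WeierstrassCurve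
open Literature.NumberTheory.EllipticCurves Literature.NumberTheory.EllipticCurves.GreenbergSelmer
open Literature.NumberTheory.GaloisRepresentations Literature.NumberTheory.IwasawaTheory Literature.NumberTheory.NumberFields
open Literature.NumberTheory.EllipticCurves.FineSelmerReducibleIsotypic Literature.NumberTheory.EllipticCurves.CoatesSujatha2005
open Literature.NumberTheory.EllipticCurves.ZpExtension
open Summit.BirchSwinnertonDyer.BirchSwinnertonDyer.Theorems
open Summit.BirchSwinnertonDyer.BirchSwinnertonDyer.Theorems.ReducibleFineSelmerCharacterFields

namespace Summit.BirchSwinnertonDyer.BirchSwinnertonDyer.Theorems.ReducibleFineSelmerLayerZero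

/-! ## §1 THE PER-ROW DOOR over `ℚ`: per side, layer-zero door OR g38's three-way `μ`-door at `ℚ(χ_i)` -/

/-- **THE LAYER-ZERO-OR-μ PER-ROW DOOR: (A) at `(W, p)` on a reducible row over `ℚ`.**  Side 1 (`χ₁` on `C`, field `ℚ(P)`): EITHER the
layer-zero door (subfield `K₁ ⊆ ℚ(χ₁,χ₂)` fixing a generator `P` of `C`, eigen-test on `Cl(𝓞_{K₁}) ⊗ 𝔽_p`, `C^{D_p} = 0`) OR the three-way
`μ`-door at `ℚ̄^{fixingSubgroup C}` (Iwasawa 1956, or for every cyclotomic `ℤ_p`-extension Fukuda's rank stability or `rank_p Cl < p^j − 1` at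
some layer); side 2 (`χ₂` on `W[p]/C`, field `ℚ(P′)`): the same modulo `C`.  Conclusion: statement (A) at `(W, p)`.
[cite: CoatesSujatha2005, §3 Thm. 3.4, Lemma 3.8 and Cor. 3.6] [cite: DeoRaySujatha2023, §3 Thm. 3.8 (c2), (c3) and §5 Lemma 5.1]
[cite: Washington1997, §13.3 Lemmas 13.14–13.16, Prop. 13.22 and Prop. 13.23] [cite: Greenberg2001IwasawaPastPresent, Prop. 2.1 p. 339] -/
theorem fineSelmerDual_moduleFinite_of_not_irreducible_of_layerZero_or_doors {p : ℕ} [hp : Fact p.Prime] (hp2 : p ≠ 2)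
    (W : WeierstrassCurve ℚ) [W.IsElliptic] (κ : ZpExtension ℚ p) (hκ : κ.IsCyclotomic)
    (C : AddSubgroup (W.geomTorsion ((p : ℕ) : ℤ)))
    (hC : ∀ (σ : absoluteGaloisGroup ℚ) (x : W.geomTorsion ((p : ℕ) : ℤ)), x ∈ C → σ • x ∈ C) (h1 : C ≠ ⊥) (h2 : C ≠ ⊤)
    (side₁ : haveI : NeZero p := ⟨hp.out.ne_zero⟩
      haveI := isGalois_borelField (W := W) hC
      ((∃ (K₁ : IntermediateField ℚ (W.borelField C)) (_ : NumberField K₁) (P : W.geomTorsion ((p : ℕ) : ℤ)),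
          P ∈ C ∧ P ≠ 0 ∧
          (∀ τ : absoluteGaloisGroup ℚ,
            (∀ x : K₁, absRestrictNormalHom (W.borelField C) τ (x : W.borelField C) = x) → τ • P = P) ∧
          (∀ μ : Additive (ClassGroup (𝓞 K₁)) →+ ZMod p,
            (∀ (τ : absoluteGaloisGroup ℚ) (σ : K₁ ≃ₐ[ℚ] K₁) (a : ℕ),
              (∀ x : K₁, absRestrictNormalHom (W.borelField C) τ (x : W.borelField C) = ((σ x : K₁) : W.borelField C)) →
              τ • P = a • P →
              ∀ (I J : (Ideal (𝓞 K₁))⁰),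
                (J : Ideal (𝓞 K₁)) = (I : Ideal (𝓞 K₁)).map (AmbiguousClass.intAut σ : 𝓞 K₁ →+* 𝓞 K₁) →
                μ (Additive.ofMul (ClassGroup.mk0 J)) = a • μ (Additive.ofMul (ClassGroup.mk0 I))) →
            μ = 0)) ∧
        (∀ v : HeightOneSpectrum (𝓞 ℚ), ((p : ℕ) : 𝓞 ℚ) ∈ v.asIdeal →
          ∀ w : W.geomTorsion ((p : ℕ) : ℤ), w ∈ C → (∀ d ∈ GreenbergSelmer.decomp v, d • w = w) → w = 0)) ∨
      ((¬ p ∣ Nat.card (ClassGroup (𝓞 ↥(fixedField (fixingSubgroup (absoluteGaloisGroup ℚ)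
          (C : Set (W.geomTorsion ((p : ℕ) : ℤ)))) : IntermediateField ℚ (AlgebraicClosure ℚ)))) ∧
        ∃! v : HeightOneSpectrum (𝓞 ↥(fixedField (fixingSubgroup (absoluteGaloisGroup ℚ)
          (C : Set (W.geomTorsion ((p : ℕ) : ℤ)))) : IntermediateField ℚ (AlgebraicClosure ℚ))),
          ((p : ℕ) : 𝓞 ↥(fixedField (fixingSubgroup (absoluteGaloisGroup ℚ)
            (C : Set (W.geomTorsion ((p : ℕ) : ℤ)))) : IntermediateField ℚ (AlgebraicClosure ℚ))) ∈ v.asIdeal) ∨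
      ∀ κ₁ : ZpExtension ↥(fixedField (fixingSubgroup (absoluteGaloisGroup ℚ)
          (C : Set (W.geomTorsion ((p : ℕ) : ℤ)))) : IntermediateField ℚ (AlgebraicClosure ℚ)) p, κ₁.IsCyclotomic →
        (∃ n : ℕ, classGroupPRank κ₁ (n + 1) = classGroupPRank κ₁ n) ∨ ∃ j : ℕ, classGroupPRank κ₁ j < p ^ j - 1))
    (side₂ : haveI : NeZero p := ⟨hp.out.ne_zero⟩
      haveI := isGalois_borelField (W := W) hC
      ((∃ (K₂ : IntermediateField ℚ (W.borelField C)) (_ : NumberField K₂) (P₂ : W.geomTorsion ((p : ℕ) : ℤ)),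
          P₂ ∉ C ∧
          (∀ τ : absoluteGaloisGroup ℚ,
            (∀ x : K₂, absRestrictNormalHom (W.borelField C) τ (x : W.borelField C) = x) → τ • P₂ - P₂ ∈ C) ∧
          (∀ μ : Additive (ClassGroup (𝓞 K₂)) →+ ZMod p,
            (∀ (τ : absoluteGaloisGroup ℚ) (σ : K₂ ≃ₐ[ℚ] K₂) (a : ℕ),
              (∀ x : K₂, absRestrictNormalHom (W.borelField C) τ (x : W.borelField C) = ((σ x : K₂) : W.borelField C)) →
              τ • P₂ - a • P₂ ∈ C →
              ∀ (I J : (Ideal (𝓞 K₂))⁰),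
                (J : Ideal (𝓞 K₂)) = (I : Ideal (𝓞 K₂)).map (AmbiguousClass.intAut σ : 𝓞 K₂ →+* 𝓞 K₂) →
                μ (Additive.ofMul (ClassGroup.mk0 J)) = a • μ (Additive.ofMul (ClassGroup.mk0 I))) →
            μ = 0)) ∧
        (∀ v : HeightOneSpectrum (𝓞 ℚ), ((p : ℕ) : 𝓞 ℚ) ∈ v.asIdeal →
          ∀ m : W.geomTorsion ((p : ℕ) : ℤ), (∀ d ∈ GreenbergSelmer.decomp v, d • m - m ∈ C) → m ∈ C)) ∨
      ((¬ p ∣ Nat.card (ClassGroup (𝓞 ↥(fixedField (fixingSubgroup (absoluteGaloisGroup ℚ)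
          (Set.range fun y : W.geomTorsion ((p : ℕ) : ℤ) => y +ᵥ (C : Set (W.geomTorsion ((p : ℕ) : ℤ))))) :
            IntermediateField ℚ (AlgebraicClosure ℚ)))) ∧
        ∃! v : HeightOneSpectrum (𝓞 ↥(fixedField (fixingSubgroup (absoluteGaloisGroup ℚ)
          (Set.range fun y : W.geomTorsion ((p : ℕ) : ℤ) => y +ᵥ (C : Set (W.geomTorsion ((p : ℕ) : ℤ))))) :
            IntermediateField ℚ (AlgebraicClosure ℚ))),
          ((p : ℕ) : 𝓞 ↥(fixedField (fixingSubgroup (absoluteGaloisGroup ℚ)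
            (Set.range fun y : W.geomTorsion ((p : ℕ) : ℤ) => y +ᵥ (C : Set (W.geomTorsion ((p : ℕ) : ℤ))))) :
              IntermediateField ℚ (AlgebraicClosure ℚ))) ∈ v.asIdeal) ∨
      ∀ κ₂ : ZpExtension ↥(fixedField (fixingSubgroup (absoluteGaloisGroup ℚ)
          (Set.range fun y : W.geomTorsion ((p : ℕ) : ℤ) => y +ᵥ (C : Set (W.geomTorsion ((p : ℕ) : ℤ))))) :
            IntermediateField ℚ (AlgebraicClosure ℚ)) p, κ₂.IsCyclotomic →
        (∃ n : ℕ, classGroupPRank κ₂ (n + 1) = classGroupPRank κ₂ n) ∨ ∃ j : ℕ, classGroupPRank κ₂ j < p ^ j - 1)) :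
    ∃ (γ : absoluteGaloisGroup ℚ) (D : W.FineSelmerDualData κ γ),
      Module.Finite ℤ_[p] (RestrictScalars ℤ_[p] (IwasawaAlgebra p) D.X) := by
  refine fineSelmerDual_moduleFinite_of_reducible_of_layerZero_or_classicalMuVanishes W hp2 κ hκ
    (EquivariantIwasawaLemma.exists_isMaximal_inertia_sup_kerSubgroup_eq_top_of_isCyclotomic hκ) C hC h1 h2 ?_ ?_
  · rcases side₁ with h | h
    · exact Or.inl h
    · exact Or.inr (classicalMuVanishes_fixedField_of_doors W C hC h1 h2 _ borelKernel_le_fixingSubgroup_coe h)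
  · rcases side₂ with h | h
    · exact Or.inl h
    · exact Or.inr (classicalMuVanishes_fixedField_of_doors W C hC h1 h2 _ (borelKernel_le_fixingSubgroup_cosets hC) h)

/-- **(c3*)₁ from the `E[p^∞]`-currency (c3) of the Deo–Ray–Sujatha facts**: «no non-zero `p`-torsion element of `W[p^∞]` fixed by `D_v`»
(i.e. `W(ℚ_v)[p] = 0`, the cell's typed per-row input) gives `C^{D_v} = 0` for every subgroup `C ≤ W[p]`.  (There is no such shortcut for
(c3*)₂ `(W[p]/C)^{D_v} = 0`: it says that `p` is not totally split in `ℚ(P′)`.) [cite: DeoRaySujatha2023, §3 Thm. 3.8 hypothesis (c3) (arXiv:2202.09937 p. 9)] -/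
theorem line_fixed_eq_zero_of_geomPrimaryTorsion {p : ℕ} [Fact p.Prime] (W : WeierstrassCurve ℚ) [W.IsElliptic]
    (C : AddSubgroup (W.geomTorsion ((p : ℕ) : ℤ)))
    (hc3 : ∀ v : HeightOneSpectrum (𝓞 ℚ), ((p : ℕ) : 𝓞 ℚ) ∈ v.asIdeal →
      ∀ x : W.geomPrimaryTorsion p, p • x = 0 → (∀ d ∈ GreenbergSelmer.decomp v, d • x = x) → x = 0) :
    ∀ v : HeightOneSpectrum (𝓞 ℚ), ((p : ℕ) : 𝓞 ℚ) ∈ v.asIdeal →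
      ∀ w : W.geomTorsion ((p : ℕ) : ℤ), w ∈ C → (∀ d ∈ GreenbergSelmer.decomp v, d • w = w) → w = 0 :=
  fun v hv w _ hw => DeoRaySujatha2023.geomTorsion_fixed_eq_zero_of_geomPrimaryTorsion W p v (hc3 v hv) w hw

/-! ## §2 The CANONICAL subfields `K₁ = F^{res(fixingSubgroup C)} = K(P)`, `K₂ = F^{res(ker χ₂)} = K(P′)`: the eigen-tests alone -/

section Canonical

variable {K : Type} [Field K] [NumberField K] (W : WeierstrassCurve K) [W.IsElliptic] {p : ℕ} [Fact p.Prime]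

/-- An intermediate field of the Borel field `K(χ₁,χ₂)` is a number field (stated for a general base `K` so that at `K = ℚ` no
`Algebra ℚ _` instance is synthesized afresh). [cite: Wuthrich2014, Lemma 14 (p. 396) (the finite extension K(χ₁,χ₂)/K)] -/
theorem numberField_intermediateField_borelField (C : AddSubgroup (W.geomTorsion (p : ℤ)))
    (E : haveI : NeZero p := ⟨(Fact.out : p.Prime).ne_zero⟩
      IntermediateField K (W.borelField C)) :
    haveI : NeZero p := ⟨(Fact.out : p.Prime).ne_zero⟩
    NumberField E := by
  haveI : NeZero p := ⟨(Fact.out : p.Prime).ne_zero⟩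
  haveI : FiniteDimensional K (W.borelField C) := finiteDimensional_borelField C
  exact NumberField.of_module_finite K E

/-- **`τ|_{K₁} = 1 ⟹ τ` fixes `C` pointwise** for the canonical `K₁ = F^{res_F(fixingSubgroup C)}` (`F = K(χ₁,χ₂)`; finite Galois
correspondence in `F/K` plus `ker(res_F) = borelKernel C ≤ fixingSubgroup C`). [cite: Wuthrich2014, Lemma 14 (p. 396)] -/
theorem smul_eq_of_forall_fixedField_line (C : AddSubgroup (W.geomTorsion (p : ℤ)))
    (hC : ∀ (σ : absoluteGaloisGroup K) (x : W.geomTorsion (p : ℤ)), x ∈ C → σ • x ∈ C)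
    (τ : absoluteGaloisGroup K)
    (hτ : haveI : NeZero p := ⟨(Fact.out : p.Prime).ne_zero⟩
      haveI := isGalois_borelField (W := W) hC
      ∀ x : (fixedField ((fixingSubgroup (absoluteGaloisGroup K) (C : Set (W.geomTorsion (p : ℤ)))).map
          (absRestrictNormalHom (W.borelField C))) : IntermediateField K (W.borelField C)),
        absRestrictNormalHom (W.borelField C) τ (x : W.borelField C) = x)
    (P : W.geomTorsion (p : ℤ)) (hP : P ∈ C) : τ • P = P := by
  haveI : NeZero p := ⟨(Fact.out : p.Prime).ne_zero⟩
  haveI := isGalois_borelField (W := W) hC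
  haveI : FiniteDimensional K (W.borelField C) := finiteDimensional_borelField C
  have hNopen : IsOpen (W.borelKernel C : Set (absoluteGaloisGroup K)) := isOpen_borelKernel C
  set S := (fixingSubgroup (absoluteGaloisGroup K) (C : Set (W.geomTorsion (p : ℤ)))).map
    (absRestrictNormalHom (W.borelField C)) with hS
  have hmem : absRestrictNormalHom (W.borelField C) τ ∈ (fixedField S).fixingSubgroup := by
    rw [IntermediateField.fixingSubgroup, mem_fixingSubgroup_iff]
    intro y hy
    exact hτ ⟨y, hy⟩
  rw [IntermediateField.fixingSubgroup_fixedField] at hmem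
  obtain ⟨g, hg, hgτ⟩ := Subgroup.mem_map.mp hmem
  have hker : absRestrictNormalHom (W.borelField C) (g⁻¹ * τ) = 1 := by rw [map_mul, map_inv, hgτ, inv_mul_cancel]
  have hN : g⁻¹ * τ ∈ W.borelKernel C := by
    rw [absRestrictNormalHom_eq_one_iff, borelField_def] at hker
    exact (SetLike.ext_iff.mp (fixingSubgroup_fixedField_of_isOpen _ hNopen) _).mp hker
  have hτG : τ ∈ fixingSubgroup (absoluteGaloisGroup K) (C : Set (W.geomTorsion (p : ℤ))) := by
    have := Subgroup.mul_mem _ hg (borelKernel_le_fixingSubgroup_coe hN)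
    rwa [mul_inv_cancel_left] at this
  exact (mem_fixingSubgroup_coe_iff τ).mp hτG P hP

/-- **`τ|_{K₂} = 1 ⟹ τ` acts trivially on `E[p]/C`** for the canonical `K₂ = F^{res_F(ker χ₂)}`. [cite: Wuthrich2014, Lemma 14 (p. 396)] -/
theorem smul_sub_mem_of_forall_fixedField_cosets (C : AddSubgroup (W.geomTorsion (p : ℤ)))
    (hC : ∀ (σ : absoluteGaloisGroup K) (x : W.geomTorsion (p : ℤ)), x ∈ C → σ • x ∈ C)
    (τ : absoluteGaloisGroup K)
    (hτ : haveI : NeZero p := ⟨(Fact.out : p.Prime).ne_zero⟩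
      haveI := isGalois_borelField (W := W) hC
      ∀ x : (fixedField ((fixingSubgroup (absoluteGaloisGroup K)
          (Set.range fun y : W.geomTorsion (p : ℤ) => y +ᵥ (C : Set (W.geomTorsion (p : ℤ))))).map
          (absRestrictNormalHom (W.borelField C))) : IntermediateField K (W.borelField C)),
        absRestrictNormalHom (W.borelField C) τ (x : W.borelField C) = x)
    (m : W.geomTorsion (p : ℤ)) : τ • m - m ∈ C := by
  haveI : NeZero p := ⟨(Fact.out : p.Prime).ne_zero⟩
  haveI := isGalois_borelField (W := W) hC
  haveI : FiniteDimensional K (W.borelField C) := finiteDimensional_borelField C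
  have hNopen : IsOpen (W.borelKernel C : Set (absoluteGaloisGroup K)) := isOpen_borelKernel C
  set S := (fixingSubgroup (absoluteGaloisGroup K)
    (Set.range fun y : W.geomTorsion (p : ℤ) => y +ᵥ (C : Set (W.geomTorsion (p : ℤ))))).map
    (absRestrictNormalHom (W.borelField C)) with hS
  have hmem : absRestrictNormalHom (W.borelField C) τ ∈ (fixedField S).fixingSubgroup := by
    rw [IntermediateField.fixingSubgroup, mem_fixingSubgroup_iff]
    intro y hy
    exact hτ ⟨y, hy⟩
  rw [IntermediateField.fixingSubgroup_fixedField] at hmem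
  obtain ⟨g, hg, hgτ⟩ := Subgroup.mem_map.mp hmem
  have hker : absRestrictNormalHom (W.borelField C) (g⁻¹ * τ) = 1 := by rw [map_mul, map_inv, hgτ, inv_mul_cancel]
  have hN : g⁻¹ * τ ∈ W.borelKernel C := by
    rw [absRestrictNormalHom_eq_one_iff, borelField_def] at hker
    exact (SetLike.ext_iff.mp (fixingSubgroup_fixedField_of_isOpen _ hNopen) _).mp hker
  have hτG : τ ∈ fixingSubgroup (absoluteGaloisGroup K)
      (Set.range fun y : W.geomTorsion (p : ℤ) => y +ᵥ (C : Set (W.geomTorsion (p : ℤ)))) := by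
    have := Subgroup.mul_mem _ hg (borelKernel_le_fixingSubgroup_cosets hC hN)
    rwa [mul_inv_cancel_left] at this
  exact (mem_fixingSubgroup_cosets_iff hC τ).mp hτG m

/-- **(A) on a reducible row from the two EIGEN-TESTS at the canonical fields `K₁ = F^{res(fixingSubgroup C)} = K(P)`,
`K₂ = F^{res(ker χ₂)} = K(P′)`** (`F = K(χ₁,χ₂)`; `P ∈ C ∖ 0`, `P₂ ∈ E[p] ∖ C`) plus `C^{D_v} = 0`, `(E[p]/C)^{D_v} = 0` above `p`.
[cite: CoatesSujatha2005, §3 Thm. 3.4, Lemma 3.8 and Cor. 3.6] [cite: DeoRaySujatha2023, §3 Thm. 3.8 (c2), (c3) and §5 Lemma 5.1] -/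
theorem fineSelmerDual_moduleFinite_of_reducible_of_eigenTests (hp : p ≠ 2)
    (κ : ZpExtension K p) (hκ : κ.IsCyclotomic)
    (hram : ∃ 𝔓' : Ideal (absIntegers (𝓞 K) K), 𝔓'.IsMaximal ∧
      𝔓'.inertia (absoluteGaloisGroup K) ⊔ κ.kerSubgroup = ⊤)
    (C : AddSubgroup (W.geomTorsion (p : ℤ)))
    (hC : ∀ (σ : absoluteGaloisGroup K) (x : W.geomTorsion (p : ℤ)), x ∈ C → σ • x ∈ C)
    (h1 : C ≠ ⊥) (h2 : C ≠ ⊤)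
    (P : W.geomTorsion (p : ℤ)) (hPC : P ∈ C) (hP0 : P ≠ 0)
    (P₂ : W.geomTorsion (p : ℤ)) (hP₂ : P₂ ∉ C)
    (hEig₁ : haveI : NeZero p := ⟨(Fact.out : p.Prime).ne_zero⟩
      haveI := isGalois_borelField (W := W) hC
      haveI := numberField_intermediateField_borelField W C
        (fixedField ((fixingSubgroup (absoluteGaloisGroup K) (C : Set (W.geomTorsion (p : ℤ)))).map
          (absRestrictNormalHom (W.borelField C))))
      ∀ μ : Additive (ClassGroup (𝓞 ↥(fixedField ((fixingSubgroup (absoluteGaloisGroup K) (C : Set (W.geomTorsion (p : ℤ)))).map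
          (absRestrictNormalHom (W.borelField C))) : IntermediateField K (W.borelField C)))) →+ ZMod p,
        (∀ (τ : absoluteGaloisGroup K)
            (σ : ↥(fixedField ((fixingSubgroup (absoluteGaloisGroup K) (C : Set (W.geomTorsion (p : ℤ)))).map
                (absRestrictNormalHom (W.borelField C))) : IntermediateField K (W.borelField C)) ≃ₐ[K]
              ↥(fixedField ((fixingSubgroup (absoluteGaloisGroup K) (C : Set (W.geomTorsion (p : ℤ)))).map
                (absRestrictNormalHom (W.borelField C))) : IntermediateField K (W.borelField C)))
            (a : ℕ),
          (∀ x : ↥(fixedField ((fixingSubgroup (absoluteGaloisGroup K) (C : Set (W.geomTorsion (p : ℤ)))).map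
                (absRestrictNormalHom (W.borelField C))) : IntermediateField K (W.borelField C)),
            absRestrictNormalHom (W.borelField C) τ (x : W.borelField C) = ((σ x : ↥(fixedField ((fixingSubgroup (absoluteGaloisGroup K) (C : Set (W.geomTorsion (p : ℤ)))).map
                (absRestrictNormalHom (W.borelField C))) : IntermediateField K (W.borelField C))) : W.borelField C)) →
          τ • P = a • P →
          ∀ (I J : (Ideal (𝓞 ↥(fixedField ((fixingSubgroup (absoluteGaloisGroup K) (C : Set (W.geomTorsion (p : ℤ)))).map
              (absRestrictNormalHom (W.borelField C))) : IntermediateField K (W.borelField C))))⁰),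
            (J : Ideal (𝓞 ↥(fixedField ((fixingSubgroup (absoluteGaloisGroup K) (C : Set (W.geomTorsion (p : ℤ)))).map
                (absRestrictNormalHom (W.borelField C))) : IntermediateField K (W.borelField C)))) =
              (I : Ideal (𝓞 ↥(fixedField ((fixingSubgroup (absoluteGaloisGroup K) (C : Set (W.geomTorsion (p : ℤ)))).map
                (absRestrictNormalHom (W.borelField C))) : IntermediateField K (W.borelField C)))).map (AmbiguousClass.intAut σ : 𝓞 ↥(fixedField ((fixingSubgroup (absoluteGaloisGroup K) (C : Set (W.geomTorsion (p : ℤ)))).map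
                (absRestrictNormalHom (W.borelField C))) : IntermediateField K (W.borelField C)) →+* 𝓞 ↥(fixedField ((fixingSubgroup (absoluteGaloisGroup K) (C : Set (W.geomTorsion (p : ℤ)))).map
                (absRestrictNormalHom (W.borelField C))) : IntermediateField K (W.borelField C))) →
            μ (Additive.ofMul (ClassGroup.mk0 J)) = a • μ (Additive.ofMul (ClassGroup.mk0 I))) →
        μ = 0)
    (hD₁ : ∀ v : HeightOneSpectrum (𝓞 K), ((p : ℕ) : 𝓞 K) ∈ v.asIdeal →
      ∀ w : W.geomTorsion (p : ℤ), w ∈ C → (∀ d ∈ GreenbergSelmer.decomp v, d • w = w) → w = 0)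
    (hEig₂ : haveI : NeZero p := ⟨(Fact.out : p.Prime).ne_zero⟩
      haveI := isGalois_borelField (W := W) hC
      haveI := numberField_intermediateField_borelField W C
        (fixedField ((fixingSubgroup (absoluteGaloisGroup K)
          (Set.range fun y : W.geomTorsion (p : ℤ) => y +ᵥ (C : Set (W.geomTorsion (p : ℤ))))).map
          (absRestrictNormalHom (W.borelField C))))
      ∀ μ : Additive (ClassGroup (𝓞 ↥(fixedField ((fixingSubgroup (absoluteGaloisGroup K)
          (Set.range fun y : W.geomTorsion (p : ℤ) => y +ᵥ (C : Set (W.geomTorsion (p : ℤ))))).map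
          (absRestrictNormalHom (W.borelField C))) : IntermediateField K (W.borelField C)))) →+ ZMod p,
        (∀ (τ : absoluteGaloisGroup K)
            (σ : ↥(fixedField ((fixingSubgroup (absoluteGaloisGroup K)
                (Set.range fun y : W.geomTorsion (p : ℤ) => y +ᵥ (C : Set (W.geomTorsion (p : ℤ))))).map
                (absRestrictNormalHom (W.borelField C))) : IntermediateField K (W.borelField C)) ≃ₐ[K]
              ↥(fixedField ((fixingSubgroup (absoluteGaloisGroup K)
                (Set.range fun y : W.geomTorsion (p : ℤ) => y +ᵥ (C : Set (W.geomTorsion (p : ℤ))))).map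
                (absRestrictNormalHom (W.borelField C))) : IntermediateField K (W.borelField C)))
            (a : ℕ),
          (∀ x : ↥(fixedField ((fixingSubgroup (absoluteGaloisGroup K)
                (Set.range fun y : W.geomTorsion (p : ℤ) => y +ᵥ (C : Set (W.geomTorsion (p : ℤ))))).map
                (absRestrictNormalHom (W.borelField C))) : IntermediateField K (W.borelField C)),
            absRestrictNormalHom (W.borelField C) τ (x : W.borelField C) = ((σ x : ↥(fixedField ((fixingSubgroup (absoluteGaloisGroup K)
                (Set.range fun y : W.geomTorsion (p : ℤ) => y +ᵥ (C : Set (W.geomTorsion (p : ℤ))))).map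
                (absRestrictNormalHom (W.borelField C))) : IntermediateField K (W.borelField C))) : W.borelField C)) →
          τ • P₂ - a • P₂ ∈ C →
          ∀ (I J : (Ideal (𝓞 ↥(fixedField ((fixingSubgroup (absoluteGaloisGroup K)
              (Set.range fun y : W.geomTorsion (p : ℤ) => y +ᵥ (C : Set (W.geomTorsion (p : ℤ))))).map
              (absRestrictNormalHom (W.borelField C))) : IntermediateField K (W.borelField C))))⁰),
            (J : Ideal (𝓞 ↥(fixedField ((fixingSubgroup (absoluteGaloisGroup K)
                (Set.range fun y : W.geomTorsion (p : ℤ) => y +ᵥ (C : Set (W.geomTorsion (p : ℤ))))).map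
                (absRestrictNormalHom (W.borelField C))) : IntermediateField K (W.borelField C)))) =
              (I : Ideal (𝓞 ↥(fixedField ((fixingSubgroup (absoluteGaloisGroup K)
                (Set.range fun y : W.geomTorsion (p : ℤ) => y +ᵥ (C : Set (W.geomTorsion (p : ℤ))))).map
                (absRestrictNormalHom (W.borelField C))) : IntermediateField K (W.borelField C)))).map (AmbiguousClass.intAut σ : 𝓞 ↥(fixedField ((fixingSubgroup (absoluteGaloisGroup K)
                (Set.range fun y : W.geomTorsion (p : ℤ) => y +ᵥ (C : Set (W.geomTorsion (p : ℤ))))).map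
                (absRestrictNormalHom (W.borelField C))) : IntermediateField K (W.borelField C)) →+* 𝓞 ↥(fixedField ((fixingSubgroup (absoluteGaloisGroup K)
                (Set.range fun y : W.geomTorsion (p : ℤ) => y +ᵥ (C : Set (W.geomTorsion (p : ℤ))))).map
                (absRestrictNormalHom (W.borelField C))) : IntermediateField K (W.borelField C))) →
            μ (Additive.ofMul (ClassGroup.mk0 J)) = a • μ (Additive.ofMul (ClassGroup.mk0 I))) →
        μ = 0)
    (hD₂ : ∀ v : HeightOneSpectrum (𝓞 K), ((p : ℕ) : 𝓞 K) ∈ v.asIdeal →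
      ∀ m : W.geomTorsion (p : ℤ), (∀ d ∈ GreenbergSelmer.decomp v, d • m - m ∈ C) → m ∈ C) :
    ∃ (γ : absoluteGaloisGroup K) (D : W.FineSelmerDualData κ γ),
      Module.Finite ℤ_[p] (RestrictScalars ℤ_[p] (IwasawaAlgebra p) D.X) := by
  haveI : NeZero p := ⟨(Fact.out : p.Prime).ne_zero⟩
  haveI := isGalois_borelField (W := W) hC
  exact fineSelmerDual_moduleFinite_of_reducible_of_layerZero_or_classGroupPRank_le W hp κ hκ hram C hC h1 h2
    (Or.inl ⟨⟨_, numberField_intermediateField_borelField W C _, P, hPC, hP0,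
      fun τ hτ => smul_eq_of_forall_fixedField_line W C hC τ hτ P hPC, hEig₁⟩, hD₁⟩)
    (Or.inl ⟨⟨_, numberField_intermediateField_borelField W C _, P₂, hP₂,
      fun τ hτ => smul_sub_mem_of_forall_fixedField_cosets W C hC τ hτ P₂, hEig₂⟩, hD₂⟩)

end Canonical

end Summit.BirchSwinnertonDyer.BirchSwinnertonDyer.Theorems.ReducibleFineSelmerLayerZero

end
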